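import Mathlib.Analysis.InnerProductSpace.PiL2
import Mathlib.Analysis.SpecialFunctions.Pow.Real
import Mathlib.Analysis.SpecialFunctions.Sqrt
import Mathlib.Analysis.SpecialFunctions.Integrals.Basic
import Mathlib.Analysis.Normed.Group.BallSphere
import HarnessLib

/-!
# The boosted-monopole Bondi mass aspect `K_v(n) = γ_v⁻³ (1 − v·n)⁻³` and atomic mass aspects

Topic `Literature/Geometry/Lorentzian` (Mathlib only; objects of route
`FinalStateConjecture/AtomicSupermomentum`, definition request `defn-BoostedMonopoleKernel`,
wanted for the signatures of `SupermomentumAtomicity` (stmt-FinalStateConjecture-9973) and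
`ScriToBulkRadiationZone` (stmt-9977); the route items `KernelMomentum` (stmt-9946) and
`KernelIndependence` (stmt-9947) inline the very expression defined here).

Source: G. Compère, R. Oliveri, A. Seraj, *The Poincaré and BMS flux-balance laws with application
to binary systems*, JHEP 10 (2020) 116 (arXiv:1912.03164), §5.2: "In any given boosted frame
determined by the velocity `v⃗`, [the Bondi mass aspect] is given by [Bondi–van der Burg–Metzner
1962] `m = m_rest / (γ³ (1 − v⃗·n⃗)³)`, `γ(v) = 1/√(1 − v²)`, `n⃗·n⃗ = 1` … The boosted energy
`∮ m = γ m_rest` … `∮ m nᵢ = γ m_rest vᵢ`" (units `c = 1`); §5.3: an initial binary has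
`m|_init = m₁/(γ₁³(1 − v⃗₁·n⃗)³) + m₂/(γ₂³(1 − v⃗₂·n⃗)³)`. The original is H. Bondi, M. van der
Burg, A. Metzner, Proc. R. Soc. A 269 (1962) 21.

## Contents (namespace `Literature.Geometry.Lorentzian`; everything proved, no named facts)

* `boostedMonopoleKernel v n = √(1 − ‖v‖²)³ · ((1 − ⟪v, n⟫)⁻¹)³` for `v : ℝ³`
  (`EuclideanSpace ℝ (Fin 3)`) and `n` on the unit sphere — the late-time mass aspect of a unit-mass
  hole boosted to velocity `v`, `‖v‖ < 1`; it is SYNTACTICALLY the expression inlined in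
  `KernelMomentum` / `KernelIndependence` (`boostedMonopoleKernel_eq` is `rfl`).
* `IsAtomicMassAspect m∞ N M v` — `m∞ = Σ_{i<N} Mᵢ K_{vᵢ}` with `Mᵢ > 0`, `‖vᵢ‖ < 1`, `vᵢ`
  pairwise distinct (the form of the initial/final data of §5.3, one term per black hole).
* API: `one_sub_inner_pos` (`1 − ⟪v,n⟫ ≥ 1 − ‖v‖ > 0`), `boostedMonopoleKernel_pos`,
  `boostedMonopoleKernel_zero` (`K_0 ≡ 1`, Schwarzschild at rest), the two-sided Doppler bounds
  `boostedMonopoleKernel_le` / `le_boostedMonopoleKernel`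
  (`γ⁻³(1+‖v‖)⁻³ ≤ K_v ≤ γ⁻³(1−‖v‖)⁻³`), `continuous_boostedMonopoleKernel`,
  `IsAtomicMassAspect.nonneg` / `.pos`.

Not here: the sphere averages `⨍ K_v = γ_v`, `⨍ K_v n = γ_v v` (these are the route's own
support item `KernelMomentum`) and linear independence of the kernels (`KernelIndependence`).

## References

* G. Compère, R. Oliveri, A. Seraj, JHEP 10 (2020) 116 (arXiv:1912.03164), §5.2 (boosted Bondi
  mass aspect and its first two moments), §5.3 (binary initial state), App. "Construction of
  boosted supertranslated Kerr". [CompereOliveriSeraj2020]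
* H. Bondi, M. G. J. van der Burg, A. W. K. Metzner, *Gravitational waves in general relativity
  VII*, Proc. R. Soc. A 269 (1962) 21–52 (origin; cited through Compère–Oliveri–Seraj, not re-read).
  [BondiVanderburgMetzner1962]
-/

noncomputable section

open scoped InnerProductSpace BigOperators

namespace Literature.Geometry.Lorentzian

/-- **The boosted-monopole kernel** `K_v(n) = (1 − ‖v‖²)^{3/2} (1 − ⟪v, n⟫)⁻³` on the unit sphere:
the Bondi mass aspect, at late retarded time, of a unit-mass black hole moving with velocity `v`,
`‖v‖ < 1` (Compère–Oliveri–Seraj 2020, §5.2, after Bondi–van der Burg–Metzner 1962: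
`m = m_rest/(γ³(1 − v⃗·n⃗)³)`, `γ = 1/√(1 − v²)`). Written exactly as inlined in the route items
`KernelMomentum` / `KernelIndependence`; junk (but harmless) values for `‖v‖ ≥ 1`.
[cite: CompereOliveriSeraj2020, §5.2 (boosted Bondi mass aspect)] -/
def boostedMonopoleKernel (v : EuclideanSpace ℝ (Fin 3)) (n : Metric.sphere (0 : EuclideanSpace ℝ (Fin 3)) 1) : ℝ :=
  Real.sqrt (1 - ‖v‖ ^ 2) ^ 3 * ((1 - ⟪v, (n : EuclideanSpace ℝ (Fin 3))⟫_ℝ)⁻¹) ^ 3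

/-- The `rfl` bridge to the inlined expression. [folklore] -/
theorem boostedMonopoleKernel_eq (v : EuclideanSpace ℝ (Fin 3)) (n : Metric.sphere (0 : EuclideanSpace ℝ (Fin 3)) 1) :
    boostedMonopoleKernel v n = Real.sqrt (1 - ‖v‖ ^ 2) ^ 3 * ((1 - ⟪v, (n : EuclideanSpace ℝ (Fin 3))⟫_ℝ)⁻¹) ^ 3 :=
  rfl

/-- **Atomic mass aspect**: `m∞ = Σ_{i<N} Mᵢ K_{vᵢ}` with positive masses `Mᵢ`, subluminal and
pairwise distinct velocities `vᵢ` — one boosted monopole per black hole, the form of the late-time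
(and, for a binary, initial: Compère–Oliveri–Seraj §5.3, `m|_init = Σₐ mₐ/(γₐ³(1 − v⃗ₐ·n⃗)³)`) Bondi
mass aspect in the route `AtomicSupermomentum`. [cite: CompereOliveriSeraj2020, §5.3 (binary system, mass aspect)] -/
def IsAtomicMassAspect (mInf : Metric.sphere (0 : EuclideanSpace ℝ (Fin 3)) 1 → ℝ) (N : ℕ) (M : Fin N → ℝ) (v : Fin N → EuclideanSpace ℝ (Fin 3)) :
    Prop :=
  (∀ i, 0 < M i) ∧ (∀ i, ‖v i‖ < 1) ∧ Function.Injective v ∧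
    ∀ n, mInf n = ∑ i, M i * boostedMonopoleKernel (v i) n

/-! ### Elementary properties -/

/-- On the unit sphere `⟪v, n⟫ ≤ ‖v‖`, so `1 − ⟪v, n⟫ ≥ 1 − ‖v‖ > 0` for subluminal `v`. [folklore] -/
theorem one_sub_norm_le_one_sub_inner (v : EuclideanSpace ℝ (Fin 3)) (n : Metric.sphere (0 : EuclideanSpace ℝ (Fin 3)) 1) :
    1 - ‖v‖ ≤ 1 - ⟪v, (n : EuclideanSpace ℝ (Fin 3))⟫_ℝ := by
  have hn : ‖(n : EuclideanSpace ℝ (Fin 3))‖ = 1 := mem_sphere_zero_iff_norm.1 n.2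
  have := real_inner_le_norm v (n : EuclideanSpace ℝ (Fin 3))
  rw [hn, mul_one] at this
  linarith

/-- … and `1 − ⟪v, n⟫ ≤ 1 + ‖v‖`. [folklore] -/
theorem one_sub_inner_le_one_add_norm (v : EuclideanSpace ℝ (Fin 3)) (n : Metric.sphere (0 : EuclideanSpace ℝ (Fin 3)) 1) :
    1 - ⟪v, (n : EuclideanSpace ℝ (Fin 3))⟫_ℝ ≤ 1 + ‖v‖ := by
  have hn : ‖(n : EuclideanSpace ℝ (Fin 3))‖ = 1 := mem_sphere_zero_iff_norm.1 n.2
  have := real_inner_le_norm (-v) (n : EuclideanSpace ℝ (Fin 3))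
  rw [norm_neg, hn, mul_one, inner_neg_left] at this
  linarith

/-- `1 − ⟪v, n⟫ > 0` for `‖v‖ < 1`. [folklore] -/
theorem one_sub_inner_pos {v : EuclideanSpace ℝ (Fin 3)} (hv : ‖v‖ < 1) (n : Metric.sphere (0 : EuclideanSpace ℝ (Fin 3)) 1) :
    0 < 1 - ⟪v, (n : EuclideanSpace ℝ (Fin 3))⟫_ℝ :=
  lt_of_lt_of_le (by linarith) (one_sub_norm_le_one_sub_inner v n)

/-- The kernel is positive for subluminal velocities. [cite: CompereOliveriSeraj2020, §5.2] -/
theorem boostedMonopoleKernel_pos {v : EuclideanSpace ℝ (Fin 3)} (hv : ‖v‖ < 1) (n : Metric.sphere (0 : EuclideanSpace ℝ (Fin 3)) 1) :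
    0 < boostedMonopoleKernel v n := by
  have h1 : 0 < 1 - ‖v‖ ^ 2 := by nlinarith [norm_nonneg v]
  have h2 := one_sub_inner_pos hv n
  unfold boostedMonopoleKernel
  positivity

/-- **At rest the mass aspect is the constant `1`** (Schwarzschild of unit mass): `K_0 ≡ 1`.
[cite: CompereOliveriSeraj2020, §5.2] -/
@[simp] theorem boostedMonopoleKernel_zero (n : Metric.sphere (0 : EuclideanSpace ℝ (Fin 3)) 1) :
    boostedMonopoleKernel 0 n = 1 := by
  simp [boostedMonopoleKernel]

/-- **Doppler upper bound**: `K_v(n) ≤ (1 − ‖v‖²)^{3/2} (1 − ‖v‖)⁻³` (attained in the direction of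
motion). [folklore] -/
theorem boostedMonopoleKernel_le {v : EuclideanSpace ℝ (Fin 3)} (hv : ‖v‖ < 1) (n : Metric.sphere (0 : EuclideanSpace ℝ (Fin 3)) 1) :
    boostedMonopoleKernel v n ≤ Real.sqrt (1 - ‖v‖ ^ 2) ^ 3 * ((1 - ‖v‖)⁻¹) ^ 3 := by
  unfold boostedMonopoleKernel
  have h0 : 0 < 1 - ‖v‖ := by linarith
  have h1 := one_sub_inner_pos hv n
  exact mul_le_mul_of_nonneg_left
    (pow_le_pow_left₀ (inv_nonneg.2 h1.le) (inv_anti₀ h0 (one_sub_norm_le_one_sub_inner v n)) 3)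
    (pow_nonneg (Real.sqrt_nonneg _) 3)

/-- **Doppler lower bound**: `(1 − ‖v‖²)^{3/2} (1 + ‖v‖)⁻³ ≤ K_v(n)` (attained opposite to the
motion). [folklore] -/
theorem le_boostedMonopoleKernel {v : EuclideanSpace ℝ (Fin 3)} (hv : ‖v‖ < 1) (n : Metric.sphere (0 : EuclideanSpace ℝ (Fin 3)) 1) :
    Real.sqrt (1 - ‖v‖ ^ 2) ^ 3 * ((1 + ‖v‖)⁻¹) ^ 3 ≤ boostedMonopoleKernel v n := by
  unfold boostedMonopoleKernel
  have h0 : 0 < 1 + ‖v‖ := by linarith [norm_nonneg v]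
  have h1 := one_sub_inner_pos hv n
  exact mul_le_mul_of_nonneg_left
    (pow_le_pow_left₀ (inv_nonneg.2 h0.le) (inv_anti₀ h1 (one_sub_inner_le_one_add_norm v n)) 3)
    (pow_nonneg (Real.sqrt_nonneg _) 3)

/-- The kernel is a continuous function on the sphere (for `‖v‖ < 1`; in particular bounded and
integrable for the finite uniform measure). [folklore] -/
theorem continuous_boostedMonopoleKernel {v : EuclideanSpace ℝ (Fin 3)} (hv : ‖v‖ < 1) :
    Continuous fun n : Metric.sphere (0 : EuclideanSpace ℝ (Fin 3)) 1 => boostedMonopoleKernel v n := by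
  unfold boostedMonopoleKernel
  refine continuous_const.mul ((Continuous.inv₀ ?_ fun n => (one_sub_inner_pos hv n).ne').pow 3)
  exact continuous_const.sub (continuous_const.inner continuous_subtype_val)

/-! ### Atomic mass aspects -/

namespace IsAtomicMassAspect

variable {mInf : Metric.sphere (0 : EuclideanSpace ℝ (Fin 3)) 1 → ℝ} {N : ℕ} {M : Fin N → ℝ} {v : Fin N → EuclideanSpace ℝ (Fin 3)}

/-- An atomic mass aspect is pointwise nonnegative. [folklore] -/
theorem nonneg (h : IsAtomicMassAspect mInf N M v) (n : Metric.sphere (0 : EuclideanSpace ℝ (Fin 3)) 1) : 0 ≤ mInf n := by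
  rw [h.2.2.2 n]
  exact Finset.sum_nonneg fun i _ =>
    mul_nonneg (h.1 i).le (boostedMonopoleKernel_pos (h.2.1 i) n).le

/-- … and pointwise positive as soon as there is at least one black hole. [folklore] -/
theorem pos (h : IsAtomicMassAspect mInf N M v) (hN : 0 < N) (n : Metric.sphere (0 : EuclideanSpace ℝ (Fin 3)) 1) :
    0 < mInf n := by
  rw [h.2.2.2 n]
  haveI : Nonempty (Fin N) := ⟨⟨0, hN⟩⟩
  exact Finset.sum_pos (fun i _ => mul_pos (h.1 i) (boostedMonopoleKernel_pos (h.2.1 i) n))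
    Finset.univ_nonempty

/-- The masses and velocities entering an atomic mass aspect (restating the side conditions).
[folklore] -/
theorem mass_pos (h : IsAtomicMassAspect mInf N M v) (i : Fin N) : 0 < M i := h.1 i

/-- Subluminal velocities. [folklore] -/
theorem norm_velocity_lt_one (h : IsAtomicMassAspect mInf N M v) (i : Fin N) : ‖v i‖ < 1 := h.2.1 i

end IsAtomicMassAspect

/-- A single boosted monopole of mass `M > 0` and velocity `‖v‖ < 1` is an atomic mass aspect with
`N = 1`. [cite: CompereOliveriSeraj2020, §5.2] -/
theorem isAtomicMassAspect_single {M₀ : ℝ} (hM : 0 < M₀) {v₀ : EuclideanSpace ℝ (Fin 3)} (hv : ‖v₀‖ < 1) :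
    IsAtomicMassAspect (fun n => M₀ * boostedMonopoleKernel v₀ n) 1 (fun _ => M₀) fun _ => v₀ :=
  ⟨fun _ => hM, fun _ => hv, fun a b _ => Subsingleton.elim a b, fun n => by simp⟩

/-! ### Further API (appended 2026-08-15: printed form, symmetries, profile integrals, atoms)

Sources as above: Compère–Oliveri–Seraj 2020 §5.2 (`m = m_rest γ⁻³(1 − v⃗·n⃗)⁻³`, invariance of
the mass aspect under rotations, the moments `∮ m = γ m_rest`, `∮ m nᵢ = γ m_rest vᵢ`) and §5.3
(sums of boosted monopoles). The two `[-1, 1]` integrals below are the one-variable reductions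
(`s = ‖v‖`, Archimedes' projection `∮_{S²} F(v⃗·n⃗) dΩ = 2π ∫_{-1}^{1} F(s x) dx`) of the sphere
moments: `2π · 2/(1 − s²)² · (1 − s²)^{3/2} / (4π) = γ` and `2π · 2s/(1 − s²)² · (1 − s²)^{3/2} / (4π)
= γ s`; the sphere-average identities themselves remain the route item `KernelMomentum`. -/

/-- Function-level `rfl` bridge: `boostedMonopoleKernel` *is* the two-argument lambda inlined in
`KernelIndependence` (so that item reads `LinearIndependent ℝ (fun v : ball 0 1 ↦
boostedMonopoleKernel v)` definitionally). [folklore] -/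
theorem boostedMonopoleKernel_def :
    boostedMonopoleKernel = fun (v : EuclideanSpace ℝ (Fin 3))
      (n : Metric.sphere (0 : EuclideanSpace ℝ (Fin 3)) 1) ↦
        Real.sqrt (1 - ‖v‖ ^ 2) ^ 3 * ((1 - ⟪v, (n : EuclideanSpace ℝ (Fin 3))⟫_ℝ)⁻¹) ^ 3 :=
  rfl

/-- The printed form `K_v(n) = (1 − ‖v‖²)^{3/2} / (1 − ⟪v, n⟫)³ = γ_v⁻³ (1 − v⃗·n⃗)⁻³`
(Compère–Oliveri–Seraj 2020 §5.2, the Bondi mass aspect in a boosted frame, after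
Bondi–van der Burg–Metzner 1962), valid for `‖v‖ ≤ 1`. [cite: CompereOliveriSeraj2020, §5.2] -/
theorem boostedMonopoleKernel_eq_rpow_div {v : EuclideanSpace ℝ (Fin 3)} (hv : ‖v‖ ≤ 1)
    (n : Metric.sphere (0 : EuclideanSpace ℝ (Fin 3)) 1) :
    boostedMonopoleKernel v n =
      (1 - ‖v‖ ^ 2) ^ (3 / 2 : ℝ) / (1 - ⟪v, (n : EuclideanSpace ℝ (Fin 3))⟫_ℝ) ^ 3 := by
  have h1 : 0 ≤ 1 - ‖v‖ ^ 2 := by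
    have := norm_nonneg v
    nlinarith
  have h3 : Real.sqrt (1 - ‖v‖ ^ 2) ^ 3 = (1 - ‖v‖ ^ 2) ^ (3 / 2 : ℝ) := by
    rw [Real.sqrt_eq_rpow, ← Real.rpow_natCast, ← Real.rpow_mul h1]
    norm_num
  rw [boostedMonopoleKernel, h3, inv_pow, ← div_eq_mul_inv]

/-- **Rotation covariance**: for a linear isometry `A` of `ℝ³`, `K_{Av}(An) = K_v(n)` — the kernel
depends on `(v, n)` only through `‖v‖` and `⟪v, n⟫` (the mass aspect is invariant under rotations,
Compère–Oliveri–Seraj 2020 §5.2). [cite: CompereOliveriSeraj2020, §5.2] -/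
theorem boostedMonopoleKernel_map_linearIsometry
    (A : EuclideanSpace ℝ (Fin 3) →ₗᵢ[ℝ] EuclideanSpace ℝ (Fin 3)) (v : EuclideanSpace ℝ (Fin 3))
    (n : Metric.sphere (0 : EuclideanSpace ℝ (Fin 3)) 1) :
    boostedMonopoleKernel (A v) ⟨A n, by simp [norm_eq_of_mem_sphere n]⟩ =
      boostedMonopoleKernel v n := by
  simp [boostedMonopoleKernel, LinearIsometry.inner_map_map]

/-- Parity: `K_{−v}(−n) = K_v(n)` (the case `A = −1` of rotation covariance). [folklore] -/
theorem boostedMonopoleKernel_neg_neg (v : EuclideanSpace ℝ (Fin 3))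
    (n : Metric.sphere (0 : EuclideanSpace ℝ (Fin 3)) 1) :
    boostedMonopoleKernel (-v) (-n) = boostedMonopoleKernel v n := by
  simp [boostedMonopoleKernel, coe_neg_sphere]

/-- Zeroth moment of the boost profile: for `|s| < 1`,
`∫_{-1}^{1} (1 − s x)⁻³ dx = 2 / (1 − s²)²`. With `s = ‖v‖` this is the reduction of
`∮_{S²} (1 − v⃗·n⃗)⁻³ dΩ = 2π ∫_{-1}^{1} (1 − s x)⁻³ dx = 4π γ⁴` behind `⨍ K_v = γ_v`
(Compère–Oliveri–Seraj 2020 §5.2, "the boosted energy `∮ m = γ m_rest`"). The antiderivative used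
is `x (2 − s x) / (2 (1 − s x)²)`, valid also at `s = 0`. [cite: CompereOliveriSeraj2020, §5.2] -/
theorem integral_boostProfile {s : ℝ} (hs : |s| < 1) :
    ∫ x in (-1 : ℝ)..1, ((1 - s * x)⁻¹) ^ 3 = 2 / (1 - s ^ 2) ^ 2 := by
  have hs1 := (abs_lt.mp hs).1
  have hs2 := (abs_lt.mp hs).2
  have hden : ∀ x ∈ Set.uIcc (-1 : ℝ) 1, 0 < 1 - s * x := by
    intro x hx
    rw [Set.uIcc_of_le (by norm_num), Set.mem_Icc] at hx
    have hsx : |s * x| ≤ |s| := by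
      simpa [abs_mul] using mul_le_of_le_one_right (abs_nonneg s) (abs_le.mpr ⟨hx.1, hx.2⟩)
    have h' := (abs_le.mp hsx).2
    have h'' : |s| < 1 := hs
    linarith
  have hderiv : ∀ x ∈ Set.uIcc (-1 : ℝ) 1,
      HasDerivAt (fun x : ℝ ↦ x * (2 - s * x) / (2 * (1 - s * x) ^ 2))
        (((1 - s * x)⁻¹) ^ 3) x := by
    intro x hx
    have hx0 : (1 - s * x) ≠ 0 := (hden x hx).ne'
    have h := ((hasDerivAt_id x).mul ((hasDerivAt_const x (2 : ℝ)).sub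
      ((hasDerivAt_id x).const_mul s))).div
      ((((hasDerivAt_const x (1 : ℝ)).sub ((hasDerivAt_id x).const_mul s)).pow 2).const_mul 2)
      (mul_ne_zero two_ne_zero (pow_ne_zero 2 hx0))
    refine h.congr_deriv ?_
    simp only [id, Pi.mul_apply, Pi.sub_apply, Pi.pow_apply, Nat.cast_ofNat, mul_one, one_mul,
      zero_sub, mul_neg, sub_neg_eq_add]
    field_simp
    ring
  have hcont : ContinuousOn (fun x : ℝ ↦ ((1 - s * x)⁻¹) ^ 3) (Set.uIcc (-1 : ℝ) 1) :=
    ContinuousOn.pow (ContinuousOn.inv₀ (by fun_prop) fun x hx ↦ (hden x hx).ne') 3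
  have h1 : (0 : ℝ) < 1 - s * 1 := by linarith
  have h2 : (0 : ℝ) < 1 - s * -1 := by linarith
  have h3 : (0 : ℝ) < 1 - s ^ 2 := by nlinarith
  rw [intervalIntegral.integral_eq_sub_of_hasDerivAt hderiv (hcont.intervalIntegrable)]
  show (1 : ℝ) * (2 - s * 1) / (2 * (1 - s * 1) ^ 2) - (-1) * (2 - s * -1) / (2 * (1 - s * -1) ^ 2)
    = 2 / (1 - s ^ 2) ^ 2
  rw [div_sub_div _ _ (by positivity) (by positivity),
    div_eq_div_iff (by positivity) (by positivity)]
  ring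

/-- First moment of the boost profile: for `|s| < 1`,
`∫_{-1}^{1} x (1 − s x)⁻³ dx = 2 s / (1 − s²)²`; with `s = ‖v‖` it is the reduction behind
`⨍ K_v n = γ_v v` (Compère–Oliveri–Seraj 2020 §5.2, "`∮ m nᵢ = γ m_rest vᵢ`"). Antiderivative
`x² / (2 (1 − s x)²)`. [cite: CompereOliveriSeraj2020, §5.2] -/
theorem integral_mul_boostProfile {s : ℝ} (hs : |s| < 1) :
    ∫ x in (-1 : ℝ)..1, x * ((1 - s * x)⁻¹) ^ 3 = 2 * s / (1 - s ^ 2) ^ 2 := by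
  have hs1 := (abs_lt.mp hs).1
  have hs2 := (abs_lt.mp hs).2
  have hden : ∀ x ∈ Set.uIcc (-1 : ℝ) 1, 0 < 1 - s * x := by
    intro x hx
    rw [Set.uIcc_of_le (by norm_num), Set.mem_Icc] at hx
    have hsx : |s * x| ≤ |s| := by
      simpa [abs_mul] using mul_le_of_le_one_right (abs_nonneg s) (abs_le.mpr ⟨hx.1, hx.2⟩)
    have h' := (abs_le.mp hsx).2
    have h'' : |s| < 1 := hs
    linarith
  have hderiv : ∀ x ∈ Set.uIcc (-1 : ℝ) 1,
      HasDerivAt (fun x : ℝ ↦ x ^ 2 / (2 * (1 - s * x) ^ 2)) (x * ((1 - s * x)⁻¹) ^ 3) x := by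
    intro x hx
    have hx0 : (1 - s * x) ≠ 0 := (hden x hx).ne'
    have h := ((hasDerivAt_id x).pow 2).div
      ((((hasDerivAt_const x (1 : ℝ)).sub ((hasDerivAt_id x).const_mul s)).pow 2).const_mul 2)
      (mul_ne_zero two_ne_zero (pow_ne_zero 2 hx0))
    refine h.congr_deriv ?_
    simp only [id, Pi.sub_apply, Pi.pow_apply, Nat.cast_ofNat, mul_one, zero_sub, mul_neg,
      sub_neg_eq_add]
    field_simp
    ring
  have hcont : ContinuousOn (fun x : ℝ ↦ x * ((1 - s * x)⁻¹) ^ 3) (Set.uIcc (-1 : ℝ) 1) :=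
    continuousOn_id.mul
      (ContinuousOn.pow (ContinuousOn.inv₀ (by fun_prop) fun x hx ↦ (hden x hx).ne') 3)
  have h1 : (0 : ℝ) < 1 - s * 1 := by linarith
  have h2 : (0 : ℝ) < 1 - s * -1 := by linarith
  have h3 : (0 : ℝ) < 1 - s ^ 2 := by nlinarith
  rw [intervalIntegral.integral_eq_sub_of_hasDerivAt hderiv (hcont.intervalIntegrable)]
  show (1 : ℝ) ^ 2 / (2 * (1 - s * 1) ^ 2) - (-1) ^ 2 / (2 * (1 - s * -1) ^ 2)
    = 2 * s / (1 - s ^ 2) ^ 2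
  rw [div_sub_div _ _ (by positivity) (by positivity),
    div_eq_div_iff (by positivity) (by positivity)]
  ring

/-- Unfolding of `IsAtomicMassAspect` (`Iff.rfl`). [cite: CompereOliveriSeraj2020, §5.3] -/
theorem isAtomicMassAspect_iff (mInf : Metric.sphere (0 : EuclideanSpace ℝ (Fin 3)) 1 → ℝ) (N : ℕ)
    (M : Fin N → ℝ) (v : Fin N → EuclideanSpace ℝ (Fin 3)) :
    IsAtomicMassAspect mInf N M v ↔
      (∀ i, 0 < M i) ∧ (∀ i, ‖v i‖ < 1) ∧ Function.Injective v ∧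
        ∀ n, mInf n = ∑ i, M i * boostedMonopoleKernel (v i) n :=
  Iff.rfl

namespace IsAtomicMassAspect

variable {mInf : Metric.sphere (0 : EuclideanSpace ℝ (Fin 3)) 1 → ℝ} {N : ℕ} {M : Fin N → ℝ}
  {v : Fin N → EuclideanSpace ℝ (Fin 3)}

/-- The velocities of the atoms are pairwise distinct. [cite: CompereOliveriSeraj2020, §5.3] -/
theorem velocity_injective (h : IsAtomicMassAspect mInf N M v) : Function.Injective v :=
  h.2.2.1

/-- The defining identity `m∞(n) = Σ_i M i · K_{v i}(n)`. [cite: CompereOliveriSeraj2020, §5.3] -/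
theorem eq_sum (h : IsAtomicMassAspect mInf N M v)
    (n : Metric.sphere (0 : EuclideanSpace ℝ (Fin 3)) 1) :
    mInf n = ∑ i, M i * boostedMonopoleKernel (v i) n :=
  h.2.2.2 n

/-- The atoms are unordered: relabelling them by a permutation of `Fin N` gives the same notion.
[cite: CompereOliveriSeraj2020, §5.3] -/
theorem reindex (h : IsAtomicMassAspect mInf N M v) (σ : Equiv.Perm (Fin N)) :
    IsAtomicMassAspect mInf N (M ∘ σ) (v ∘ σ) := by
  refine ⟨fun i ↦ h.mass_pos (σ i), fun i ↦ h.norm_velocity_lt_one (σ i),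
    h.velocity_injective.comp σ.injective, fun n ↦ ?_⟩
  rw [h.eq_sum n]
  exact (Equiv.sum_comp σ (fun i ↦ M i * boostedMonopoleKernel (v i) n)).symm

end IsAtomicMassAspect

/-- No atoms means identically vanishing mass aspect (`N = 0 ↔ m∞ = 0`, i.e. final Bondi mass `0`).
[cite: CompereOliveriSeraj2020, §5.3] -/
theorem isAtomicMassAspect_zero_iff (mInf : Metric.sphere (0 : EuclideanSpace ℝ (Fin 3)) 1 → ℝ)
    (M : Fin 0 → ℝ) (v : Fin 0 → EuclideanSpace ℝ (Fin 3)) :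
    IsAtomicMassAspect mInf 0 M v ↔ mInf = 0 := by
  simp [IsAtomicMassAspect, funext_iff, Function.injective_of_subsingleton]

/-- One hole of rest mass `M₀ > 0` at rest: the constant mass aspect `M₀` is atomic with the single
atom `(M₀, v = 0)` (Compère–Oliveri–Seraj 2020 §5.2 with `v⃗ = 0`).
[cite: CompereOliveriSeraj2020, §5.2] -/
theorem isAtomicMassAspect_rest {M₀ : ℝ} (hM : 0 < M₀) :
    IsAtomicMassAspect (fun _ ↦ M₀) 1 (fun _ ↦ M₀) (fun _ ↦ 0) :=
  ⟨fun _ ↦ hM, fun _ ↦ by simp, Function.injective_of_subsingleton _, fun n ↦ by simp⟩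

end Literature.Geometry.Lorentzian

end
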